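import Literature.IUT.HodgeArakelov.PlusMinusTowerCoverModelPrelims
import Literature.AnabelianGeometry.EtaleTheta.Discharge.Sec2CompletionIndexAmbient

/-!
# B14 «PlusMinusTower.ofCoverModel», CORE PART 2 (proof-only): the subgroups `Π̂^±_v = cl(Π^tp_{X̲_v})`,
# `Π̂_v = cl(Π^tp_{X̲̲_v})` of an abstract completion `Π̂_C` of `Π^tp_C` — the tower's index and normality fields

S. Mochizuki, *Inter-universal Teichmüller theory II*, kurims manuscript (Dec. 2020), §2, Def. 2.3 (i) p. 67 ("`Δ̂_v` … normal open subgroup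
of `Δ̂^±_v` of index `l`", "`Δ̂^±_v` … of `Δ̂^cor_v` of index `2l`") ([IUTchII] Def 2.3 (i), kurims p.67) [claim: Mochizuki2012, status: disputed]
(D-0012 claim key; series status DISPUTED — classical profinite group theory over abc-iut-L2's [EtTh] data only; nothing of the series is
asserted); [SemiAnbd] §6 p. 69 [cite: MochizukiSemiAnbd2006, §6 p.69].  PROOF-ONLY file (abc-iut cell, seat abc-iut-L6-t19 gen 5,
HOLDER-DESIGNATE of MERGE-MAP row B14; design note HOME/staging/L6/L6-t19/B14-DESIGN.md); no definitions.  Continues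
`PlusMinusTowerCoverModelCore.lean` (part 1) and CONSUMES BY NAME abc-iut-L2-t8's ambient transport
`Sec2CompletionIndexAmbient` (p424475: `index_closure_map_map_GtpXu`, `relIndex_closure_map_map_Huu_GtpXu`,
`normal_closure_map_map_Huu_subgroupOf`) at `j := inclX` (abc-iut-L2-t1's `Π^tp_X ↪ Π^tp_C`, index `2`).

Over `M : MuTwoSetting p`, `e : M.CLevelData` (abc-iut-L2-d3), an ARBITRARY profinite completion `ι : Π^tp_C → Q`
(`IsProfiniteCompletion ι`), `Π^tp_X̲ = GtpXu l` (abc-iut-L2-t7) and `C : DoubleUnderline l` (`Π^tp_X̲̲ = C.Huu`, abc-iut-L2-t8), write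
`XU := cl ι(inclX Π^tp_X̲)`, `HU := cl ι(inclX Π^tp_X̲̲)` (print's `Π̂^±_v`, `Π̂_v` — F-L6t19g5-1: the §2 curve is `X̲_v`, type `(1,l-tors)`):

* **`index_closure_GtpXu`** `[Q : XU] = 2l`, **`relIndex_closure_Huu_GtpXu`** `[XU : HU] = l`,
  **`normal_closure_Huu_subgroupOf`** `HU ⊴ XU` given the arithmetic normality `hN : Π^tp_X̲̲ ⊴ Π^tp_X̲` (abc-iut-L2-t7's kernel
  fact for the cocycle model under `μ_l ⊆ K`, p422309) — the `j := inclX` instances of abc-iut-L2-t8's lemmas;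
* **`normal_closure_GtpXu`** `XU ⊴ Q` (mod L02 — the printed definition of `Z`; from Prelims `map_inclX_GtpXu_normal`, i.e.
  `Π^tp_X̲ ⊴ Π^tp_C`, and abc-iut-L2's `Subgroup.normal_subgroupOf_topologicalClosure_map`) — the `pmHat_normal` field;
* with ANY augmentation `Φ : Q → G_{ℚ_p}` extending `augC` with values in `G_K` (abc-iut-L2-d3's `PiCData.aug` shape; part 1's
  `exists_augHat` is one source), `K := Ker Φ` (`= Δ̂^cor_v`): **`index_fields`** `[K : XU ∩ K] = 2l`, `[XU ∩ K : HU ∩ K] = l`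
  (`deltaPmHat_index`, `deltaHat_index`; via abc-iut-L2-t2's `[A·N : A] = [N : A ∩ N]` and `HU·K = Q` from `Π^tp_X̲̲ ↠ G_K`),
  **`normal_field_pm`** `(XU ∩ K) ⊴ K` and **`normal_field`** `(HU ∩ K) ⊴ (XU ∩ K)` (`deltaPmHat_normal`, `deltaHat_normal`).

Nothing here takes a side on [IUTchIII] Cor. 3.12; typed ≠ proved.
-/

namespace Literature.AnabelianGeometry.EtaleTheta

open Literature.AnabelianGeometry.SemiGraphs

namespace MuTwoSetting

variable {p : ℕ} [Fact p.Prime] {M : MuTwoSetting p}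

/-- `[Π^tp_C : inclX(Π^tp_X)] = 2 ≠ 0` for the continuous packaging `⟨inclX, continuous_inclX⟩` of abc-iut-L2-t1's `inclX`
(the open injection `j` of abc-iut-L2-t8's ambient transport). [cite: MochizukiEtTh2009, Def 2.1 p.36] -/
theorem finiteIndex_range_inclX_mk (M : MuTwoSetting p) :
    (ContinuousMonoidHom.mk M.inclX M.continuous_inclX).toMonoidHom.range.FiniteIndex :=
  ⟨by show M.inclX.range.index ≠ 0; rw [M.index_range_inclX]; decide⟩

namespace CLevelData

variable (e : M.CLevelData) {Q : Type} [Group Q] [TopologicalSpace Q] [IsTopologicalGroup Q]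
  (ι : M.GtpC →ₜ* Q) (hι : IsProfiniteCompletion ι) {l : ℕ} {E : M.toThetaSetting.EtaleThetaData}
  (C : E.DoubleUnderline l)

/-! ### Indices and relative normality of the closures (abc-iut-L2-t8's ambient transport at `j := inclX`) -/

include e hι in
/-- **`[Π̂_C : Π̂^±_v] = 2l`**: the closure of `ι(inclX Π^tp_X̲)` has index `2l` in `Q` — abc-iut-L2-t8's `index_closure_map_map_GtpXu`
(`= l · [Π^tp_C : inclX Π^tp_X]`) with abc-iut-L2-t1's `index_range_inclX = 2`.  PROVED.
([IUTchII] Def 2.3 (i), kurims p.67) [claim: Mochizuki2012, status: disputed] -/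
theorem index_closure_GtpXu (hl : l ≠ 0) :
    ((((M.GtpXu l).map M.inclX).map ι.toMonoidHom).topologicalClosure).index = 2 * l := by
  haveI := M.finiteIndex_range_inclX_mk
  have h := ThetaSetting.index_closure_map_map_GtpXu l (ContinuousMonoidHom.mk M.inclX M.continuous_inclX) hι
    M.injective_inclX e.isOpenEmbedding_inclX.isOpenMap hl
  have h2 : (ContinuousMonoidHom.mk M.inclX M.continuous_inclX).toMonoidHom.range.index = 2 := M.index_range_inclX
  rw [h2, mul_comm] at h
  exact h

include e hι in
/-- **`[Π̂^±_v : Π̂_v] = l`**: `[cl ι(inclX Π^tp_X̲) : cl ι(inclX Π^tp_X̲̲)] = l` — abc-iut-L2-t8's `relIndex_closure_map_map_Huu_GtpXu` at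
`j := inclX`.  PROVED. ([IUTchII] Def 2.3 (i), kurims p.67) [claim: Mochizuki2012, status: disputed] -/
theorem relIndex_closure_Huu_GtpXu :
    (((C.Huu.map M.inclX).map ι.toMonoidHom).topologicalClosure).relIndex
        ((((M.GtpXu l).map M.inclX).map ι.toMonoidHom).topologicalClosure) = l := by
  haveI := M.finiteIndex_range_inclX_mk
  exact C.relIndex_closure_map_map_Huu_GtpXu (ContinuousMonoidHom.mk M.inclX M.continuous_inclX) hι
    M.injective_inclX e.isOpenEmbedding_inclX.isOpenMap

/-- **`Π̂_v ⊴ Π̂^±_v`** GIVEN the arithmetic normality `hN : Π^tp_X̲̲ ⊴ Π^tp_X̲` — abc-iut-L2-t8's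
`normal_closure_map_map_Huu_subgroupOf` at `j := inclX`.  PROVED. ([IUTchII] Def 2.3 (i), kurims p.67) [claim: Mochizuki2012, status: disputed] -/
theorem normal_closure_Huu_subgroupOf (hN : (C.Huu.subgroupOf (M.GtpXu l)).Normal) :
    ((((C.Huu.map M.inclX).map ι.toMonoidHom).topologicalClosure).subgroupOf
      ((((M.GtpXu l).map M.inclX).map ι.toMonoidHom).topologicalClosure)).Normal :=
  C.normal_closure_map_map_Huu_subgroupOf (ι := ι) (ContinuousMonoidHom.mk M.inclX M.continuous_inclX) hN

/-! ### `Π̂^±_v ⊴ Π̂_C` -/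

include hι in
/-- The closure of the image of all of `Π^tp_C` is `Q` (dense range). [cite: MochizukiSemiAnbd2006, §6 p.69] -/
theorem topologicalClosure_map_top :
    ((⊤ : Subgroup M.GtpC).map ι.toMonoidHom).topologicalClosure = ⊤ := by
  rw [eq_top_iff]
  intro x _
  change x ∈ closure ((((⊤ : Subgroup M.GtpC).map ι.toMonoidHom : Subgroup Q) : Set Q))
  rw [Subgroup.coe_map, Subgroup.coe_top, Set.image_univ]
  exact hι.denseRange x

include e hι in
/-- **`Π̂^±_v ⊴ Π̂_C`** (the `pmHat_normal` field): the closure of `ι(inclX Π^tp_X̲)` is normal in `Q`, granted the printed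
definition of `Z` (L02) — from Prelims `map_inclX_GtpXu_normal` (`Π^tp_X̲ ⊴ Π^tp_C`) and abc-iut-L2's
`Subgroup.normal_subgroupOf_topologicalClosure_map` with `cl ι(Π^tp_C) = Q`.  PROVED.
([IUTchII] Def 2.3 (i), kurims p.67) [claim: Mochizuki2012, status: disputed] -/
theorem normal_closure_GtpXu (hZ : Thm16Sub.KerToZIsCompactlyGenerated M.toThetaSetting) (l : ℕ) :
    ((((M.GtpXu l).map M.inclX).map ι.toMonoidHom).topologicalClosure).Normal := by
  haveI hn := e.map_inclX_GtpXu_normal l hZ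
  have h := Subgroup.normal_subgroupOf_topologicalClosure_map ι.toMonoidHom
    (le_top : (M.GtpXu l).map M.inclX ≤ ⊤) (Subgroup.Normal.subgroupOf hn ⊤)
  rw [topologicalClosure_map_top ι hι] at h
  exact (Subgroup.normalizer_eq_top_iff).mp
    (top_le_iff.mp ((Subgroup.normal_subgroupOf_iff_le_normalizer le_top).mp h))

/-! ### The fields relative to an augmentation `Φ : Q → G_{ℚ_p}` extending `augC` -/

/-- **`Φ(cl ι(inclX Π^tp_X̲̲)) ⊇ G_K`**: every `q ∈ Q` is `y · k` with `y ∈ cl ι(inclX Π^tp_X̲̲)` and `k ∈ Ker Φ`, for any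
homomorphism `Φ : Q → G_{ℚ_p}` extending `augC` with values in `G_K` — because already `Π^tp_X̲̲ ↠ G_K` (abc-iut-L2-t8's
`map_aug_Huu`). [cite: MochizukiEtTh2009, Prop 2.2 (iii) p.37] -/
theorem exists_mem_closure_Huu_mul (Φ : Q →* GQp p) (hΦ : ∀ g : M.GtpC, Φ (ι g) = e.augC g)
    (hΦK : ∀ q : Q, Φ q ∈ M.GK) (q : Q) :
    ∃ y ∈ (((C.Huu.map M.inclX).map ι.toMonoidHom).topologicalClosure), y⁻¹ * q ∈ Φ.ker := by
  have hq : Φ q ∈ C.Huu.map M.aug.toMonoidHom := by rw [C.map_aug_Huu]; exact hΦK q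
  obtain ⟨h, hh, hhq⟩ := hq
  refine ⟨ι (M.inclX h), Subgroup.le_topologicalClosure _ ⟨M.inclX h, ⟨h, hh, rfl⟩, rfl⟩, ?_⟩
  rw [MonoidHom.mem_ker, map_mul, map_inv, inv_mul_eq_one, hΦ, e.augC_inclX]
  exact hhq

include hι in
/-- **The index fields of the tower** ([IUTchII] Def. 2.3 (i): `[Δ̂^cor_v : Δ̂^±_v] = 2l`, `[Δ̂^±_v : Δ̂_v] = l`): with `K := Ker Φ`
(`= Δ̂^cor_v`) for any `Φ : Q → G_{ℚ_p}` extending `augC` with values in `G_K`, `[K : XU ∩ K] = [Q : XU] = 2l` and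
`[XU ∩ K : HU ∩ K] = [XU : HU] = l`, by abc-iut-L2-t2's `[A·N : A] = [N : A ∩ N]` and `exists_mem_closure_Huu_mul` (`HU·K = Q`).
PROVED (mod L02 for the first).  ([IUTchII] Def 2.3 (i), kurims p.67) [claim: Mochizuki2012, status: disputed] -/
theorem index_fields (hZ : Thm16Sub.KerToZIsCompactlyGenerated M.toThetaSetting)
    (Φ : Q →* GQp p) (hΦ : ∀ g : M.GtpC, Φ (ι g) = e.augC g) (hΦK : ∀ q : Q, Φ q ∈ M.GK) :
    (((((M.GtpXu l).map M.inclX).map ι.toMonoidHom).topologicalClosure ⊓ Φ.ker).subgroupOf Φ.ker).index = 2 * l ∧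
      ((((C.Huu.map M.inclX).map ι.toMonoidHom).topologicalClosure ⊓ Φ.ker).subgroupOf
        ((((M.GtpXu l).map M.inclX).map ι.toMonoidHom).topologicalClosure ⊓ Φ.ker)).index = l := by
  set XU := (((M.GtpXu l).map M.inclX).map ι.toMonoidHom).topologicalClosure with hXU
  set HU := ((C.Huu.map M.inclX).map ι.toMonoidHom).topologicalClosure with hHU
  set K := Φ.ker with hK
  have hHX : HU ≤ XU := Subgroup.topologicalClosure_mono (Subgroup.map_mono (Subgroup.map_mono C.Huu_le_GtpXu))
  haveI hXUn : XU.Normal := e.normal_closure_GtpXu ι hι hZ l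
  -- `HU · K = Q`, hence `XU · K = Q` and `HU · (XU ∩ K) = XU`
  have hsup : ∀ q : Q, ∃ y ∈ HU, y⁻¹ * q ∈ K := e.exists_mem_closure_Huu_mul ι C Φ hΦ hΦK
  have hXK : XU ⊔ K = ⊤ := by
    rw [eq_top_iff]
    intro q _
    obtain ⟨y, hy, hyq⟩ := hsup q
    have : q = y * (y⁻¹ * q) := by group
    rw [this]
    exact Subgroup.mul_mem_sup (hHX hy) hyq
  have hHN : HU ⊔ (XU ⊓ K) = XU := by
    refine le_antisymm (sup_le hHX inf_le_left) fun x hx => ?_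
    obtain ⟨y, hy, hyx⟩ := hsup x
    have : x = y * (y⁻¹ * x) := by group
    rw [this]
    exact Subgroup.mul_mem_sup hy (Subgroup.mem_inf.mpr ⟨XU.mul_mem (XU.inv_mem (hHX hy)) hx, hyx⟩)
  constructor
  · -- `[K : XU ∩ K] = [XU ⊔ K : XU] = [Q : XU] = 2l`
    have h1 := ThetaCovers.CoverData.relIndex_sup_eq_relIndex_of_normal XU K
    rw [hXK, Subgroup.relIndex_top_right, e.index_closure_GtpXu ι hι C.l_ne_zero,
      ← Subgroup.inf_relIndex_right] at h1
    exact h1.symm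
  · -- `[XU ∩ K : HU ∩ K] = [HU ⊔ (XU ∩ K) : HU] = [XU : HU] = l`
    have h2 := ThetaCovers.CoverData.relIndex_sup_eq_relIndex_of_normal HU (XU ⊓ K)
    rw [hHN, e.relIndex_closure_Huu_GtpXu ι hι C] at h2
    have h3 : (HU ⊓ K).subgroupOf (XU ⊓ K) = HU.subgroupOf (XU ⊓ K) := by
      ext x
      simp only [Subgroup.mem_subgroupOf, Subgroup.mem_inf]
      exact ⟨fun h => h.1, fun h => ⟨h, (Subgroup.mem_inf.mp x.2).2⟩⟩
    rw [h3]
    exact h2.symm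

include e hι in
/-- **The normality field `deltaPmHat_normal`** (`Δ̂^±_v ⊴ Δ̂^cor_v`): `(XU ∩ K) ⊴ K` for any subgroup `K` (here `Ker Φ`), from
`XU ⊴ Q` (mod L02).  PROVED. ([IUTchII] Def 2.3 (i), kurims p.67) [claim: Mochizuki2012, status: disputed] -/
theorem normal_field_pm (hZ : Thm16Sub.KerToZIsCompactlyGenerated M.toThetaSetting) (K : Subgroup Q) :
    (((((M.GtpXu l).map M.inclX).map ι.toMonoidHom).topologicalClosure ⊓ K).subgroupOf K).Normal := by
  haveI := e.normal_closure_GtpXu ι hι hZ l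
  rw [Subgroup.inf_subgroupOf_right]
  exact Subgroup.Normal.subgroupOf inferInstance K

/-- **The normality field `deltaHat_normal`** (`Δ̂_v ⊴ Δ̂^±_v`): `(HU ∩ K) ⊴ (XU ∩ K)` for any subgroup `K` (here `Ker Φ`), from
`HU ⊴ XU` (arithmetic normality input `hN`).  PROVED. ([IUTchII] Def 2.3 (i), kurims p.67) [claim: Mochizuki2012, status: disputed] -/
theorem normal_field (hN : (C.Huu.subgroupOf (M.GtpXu l)).Normal) (K : Subgroup Q) :
    ((((C.Huu.map M.inclX).map ι.toMonoidHom).topologicalClosure ⊓ K).subgroupOf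
      ((((M.GtpXu l).map M.inclX).map ι.toMonoidHom).topologicalClosure ⊓ K)).Normal := by
  haveI := normal_closure_Huu_subgroupOf ι C hN
  exact Subgroup.inf_subgroupOf_inf_normal_of_left K

end CLevelData

end MuTwoSetting

end Literature.AnabelianGeometry.EtaleTheta
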